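import Summits.ResolutionOfSingularities.ResolutionOfSingularities.Theorems.WeightedInvariantKeyRungThreeOfDropCurveFracTieZero
import Summits.ResolutionOfSingularities.ResolutionOfSingularities.Theorems.WeightedInvariantIota3Regimes
import Summits.ResolutionOfSingularities.ResolutionOfSingularities.Theorems.WeightedInvariantIota3TauStrat
import HarnessLib

/-!
# (D-b³-curve-FRAC-TIE-ZERO) ⟸ (ISO) + (SIGMA): the `ι₃ᵗ`-comparison at the pinned successor is a `σ`-comparison
# (door `HypersurfaceCentreConstruction`, stmt-ResolutionOfSingularities-19897, stub `stub_keyRungGrHomLE_three`)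

Helper for `stub_keyRungGrHomLE_three` (def-free, `--supports 19897`).  Sequel of hand -9's TIE-LOCUS.md §2 / gap list of record
`keyRungGrHomLE_three_of_tieDescent_point_curveFracTieZero` (…KeyRungThreeOfDropCurveFracTieZero).

Pure invariant plumbing, no blow-up algebra: at a CURVE-centre door position `(S, f)` (`topStratum ι₀ S f = V(P)`, `P ≠ 𝔪`,
`dim S ≤ 3`, `f ∈ 𝔪^ν ∖ 𝔪^{ν+1}`, `f ∈ P`) and a second regular local position `(R, g)` of Krull dimension `≤ 3` with THE SAME ORDER
(`g ∈ 𝔪_R^ν ∖ 𝔪_R^{ν+1}`) which is ISOLATED (`topStratum iotaOrd R g = {𝔪_R}`):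

* **`Iota3.iotaOrdEpsTau_eq_of_curve_of_isIsolated`** — the stratifiers agree: `ι₀(R, g) = ι₀(S, f)` (`ε = τ = 0` on both sides:
  at `S` because `P ≠ 𝔪` lies on the top `ι₀`-stratum, so `(S, f)` is not a tie position and `ε(S, f) = ε(S_P, f/1) = 0` in Krull
  dimension `≤ 2`; at `R` because an isolated position has `ε = 0`, `P₀ = 𝔪_R`, hence `τ = 0`);
* **`Iota3.iotaCylinder_eq_iotaSigma_of_isIsolated`** — at `R` the `σ`-cylinder is read POINTWISE: `iotaCylinder ι₀ σ R g = σ(R, g)`;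
* **`Iota3.iotaFlatT_lt_of_curve_of_isIsolated_of_iotaSigma_lt`** — HENCE `ι₃ᵗ(R, g) < ι₃ᵗ(S, f)` as soon as
  `σ(R, g) < σ(S_P, f/1)`; and **`Iota3.iotaFlatT_lt_iff_iotaSigma_lt_of_curve_of_isIsolated`** — this is an EQUIVALENCE.

Use (TIE-LOCUS.md §2): `R = B_𝔫`, `𝔫 = (t⁻¹, z, y t^b)` the pinned `t`-homogeneous successor of a fractional-slope curve centre tied at
`λ = 0`, `g` the saturated transform (`g/1 ∈ 𝔪_𝔫^ν` by …Iota3TieZeroOrderPersists).  So (D-b³-curve-FRAC-TIE-ZERO) ⟸ (ISO) «`(B_𝔫, g/1)` is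
an isolated position and `g/1 ∉ 𝔪_𝔫^{ν+1}`» + (SIGMA) «`σ(B_𝔫, g/1) < σ(S_P, f/1)`», and given (ISO) it is EQUIVALENT to (SIGMA).
[OURS · L1 W4.3 · audit glue; AI work, weaker than expert review; nothing here is a statement of the manuscript under review
(Hironaka 2017, [claim: Hironaka2017, status: under-review]).]

## References

* D. Abramovich, M. Temkin, J. Włodarczyk, *Functorial embedded resolution via weighted blowings up*, Algebra & Number Theory 18
  (2024), §5. [AbramovichTemkinWlodarczyk2024]
* res-L1-w43-plan-1 IOTA3-DESIGN v1.3 §8.2 (the invariant `ι₃ᵗ`; OURS, AI planning); hand -9, TIE-LOCUS.md §2 (crux directory).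
-/

noncomputable section

set_option linter.dupNamespace false -- mandated namespace of this single-conjunct summit

open IsLocalRing Literature.AlgebraicGeometry.Resolution
open Summit.ResolutionOfSingularities.ResolutionOfSingularities.Theorems
open Summit.ResolutionOfSingularities.ResolutionOfSingularities.Theorems.ContactCylinder

namespace Summit.ResolutionOfSingularities.ResolutionOfSingularities.Cruxes.HypersurfaceCentreConstruction.LocalEngine

namespace Iota3

section Curve

variable {S : Type} [CommRing S] [IsRegularLocalRing S] {f : S}

/-- At a curve-centre door position (`topStratum ι₀ S f = V(P)`, `P ≠ 𝔪`) the position is NOT a tie position (a tie position has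
the closed point as its top `ι₀`-stratum). [OURS · L1 W4.3] -/
theorem not_isTiePosition_of_topStratum_eq_of_ne (P : Ideal S) [P.IsPrime]
    (hE : topStratum iotaOrdEpsTau S f = {𝔮 | P ≤ 𝔮.asIdeal}) (hPm : P ≠ maximalIdeal S) : ¬ IsTiePosition S f := by
  intro h
  have h1 := topStratum_iotaOrdEpsTau_eq_closedPoint_of_isTiePosition h
  rw [hE] at h1
  have hmem : (⟨P, ‹_›⟩ : PrimeSpectrum S) ∈ {𝔮 : PrimeSpectrum S | P ≤ 𝔮.asIdeal} := (le_rfl : P ≤ P)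
  rw [h1] at hmem
  exact hPm (le_antisymm (IsLocalRing.le_maximalIdeal (Ideal.IsPrime.ne_top ‹_›)) hmem)

/-- At a curve-centre door position of Krull dimension `≤ 3`: `τ(S, f) = 0`. [OURS · L1 W4.3] -/
theorem iotaTau_eq_zero_of_topStratum_eq_of_ne (hdim : ringKrullDim S ≤ 3) (P : Ideal S) [P.IsPrime]
    (hE : topStratum iotaOrdEpsTau S f = {𝔮 | P ≤ 𝔮.asIdeal}) (hPm : P ≠ maximalIdeal S) : iotaTau S f = 0 :=
  (iotaTau_eq_zero_iff_not_isTiePosition hdim f).mpr (not_isTiePosition_of_topStratum_eq_of_ne P hE hPm)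

/-- At a curve-centre door position of Krull dimension `≤ 3` with `f ∈ P`, `f ≠ 0`: `ε(S, f) = 0` (`P` lies on the top `ι₀`-stratum, so
`ε(S, f) = ε(S_P, f/1)`, and `ε = 0` in Krull dimension `≤ 2`). [OURS · L1 W4.3] -/
theorem iotaEps_eq_zero_of_topStratum_eq_of_ne (hdim : ringKrullDim S ≤ 3) (hf0 : f ≠ 0) (P : Ideal S) [P.IsPrime]
    (hfP : f ∈ P) (hE : topStratum iotaOrdEpsTau S f = {𝔮 | P ≤ 𝔮.asIdeal}) (hPm : P ≠ maximalIdeal S) : iotaEps S f = 0 := by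
  haveI : IsDomain S := isDomain_of_isRegularLocalRing S
  haveI : IsRegularLocalRing (Localization.AtPrime P) := isRegularLocalRing_localization_atPrime S P
  have hmem : (⟨P, ‹_›⟩ : PrimeSpectrum S) ∈ topStratum iotaOrdEpsTau S f := by
    rw [hE]; exact (le_rfl : P ≤ P)
  have h0 : iotaOrdEpsTau (Localization.AtPrime P) (algebraMap S (Localization.AtPrime P) f) = iotaOrdEpsTau S f := hmem
  have hε : iotaEps (Localization.AtPrime P) (algebraMap S (Localization.AtPrime P) f) = iotaEps S f :=
    ((iotaOrdEps_eq_iff _ _ _ _).mp ((iotaOrdEpsTau_eq_iff _ _ _ _).mp h0).1).2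
  rw [← hε]
  have hdim2 : ringKrullDim (Localization.AtPrime P) ≤ 2 := ringKrullDim_localization_le_two_of_ne hdim P hPm
  have hf0' : algebraMap S (Localization.AtPrime P) f ≠ 0 := fun h =>
    hf0 ((injective_iff_map_eq_zero _).mp
      (IsLocalization.injective (Localization.AtPrime P) P.primeCompl_le_nonZeroDivisors) f h)
  have hfm : algebraMap S (Localization.AtPrime P) f ∈ maximalIdeal (Localization.AtPrime P) := by
    rw [← Localization.AtPrime.map_eq_maximalIdeal]
    exact Ideal.mem_map_of_mem _ hfP
  exact iotaEps_eq_zero_of_ringKrullDim_le_two hdim2 hf0' hfm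

/-- At a curve-centre door position of Krull dimension `≤ 3` with `f ∈ P ∩ (𝔪^ν ∖ 𝔪^{ν+1})`: the stratifier reads
`ι₀(S, f) = ω·(ω·ν + 0) + 0`. [OURS · L1 W4.3] -/
theorem iotaOrdEpsTau_eq_of_topStratum_eq_of_ne (hdim : ringKrullDim S ≤ 3) (hf0 : f ≠ 0) (P : Ideal S) [P.IsPrime]
    (hfP : f ∈ P) (hE : topStratum iotaOrdEpsTau S f = {𝔮 | P ≤ 𝔮.asIdeal}) (hPm : P ≠ maximalIdeal S)
    {ν : ℕ} (hfν : f ∈ maximalIdeal S ^ ν) (hfν1 : f ∉ maximalIdeal S ^ (ν + 1)) :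
    iotaOrdEpsTau S f = Ordinal.omega0 * (Ordinal.omega0 * (ν : Ordinal.{0})) := by
  rw [iotaOrdEpsTau_apply, iotaOrdEps_apply, (iotaOrd_eq_natCast_iff S f ν).mpr ⟨hfν, hfν1⟩,
    iotaEps_eq_zero_of_topStratum_eq_of_ne hdim hf0 P hfP hE hPm, iotaTau_eq_zero_of_topStratum_eq_of_ne hdim P hE hPm,
    add_zero, add_zero]

end Curve

section Isolated

variable {R : Type} [CommRing R] [IsRegularLocalRing R] {g : R}

/-- At an ISOLATED position of Krull dimension `≤ 3` (`g ∈ 𝔪_R`): `τ(R, g) = 0` (`P₀ = 𝔪_R`). [OURS · L1 W4.3] -/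
theorem iotaTau_eq_zero_of_isIsolatedPosition (hdim : ringKrullDim R ≤ 3) (hg : g ∈ maximalIdeal R)
    (hiso : IsIsolatedPosition R g) : iotaTau R g = 0 :=
  iotaTau_eq_zero_of_topStratumPrime_eq_maximalIdeal hdim (isPointCentrePosition_of_isIsolatedPosition hg hiso)

/-- At an isolated position of Krull dimension `≤ 3` with `g ∈ 𝔪_R^ν ∖ 𝔪_R^{ν+1}`, `ν ≥ 1`: `ι₀(R, g) = ω·(ω·ν + 0) + 0`.
[OURS · L1 W4.3] -/
theorem iotaOrdEpsTau_eq_of_isIsolatedPosition (hdim : ringKrullDim R ≤ 3) {ν : ℕ} (hν : 1 ≤ ν)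
    (hgν : g ∈ maximalIdeal R ^ ν) (hgν1 : g ∉ maximalIdeal R ^ (ν + 1)) (hiso : IsIsolatedPosition R g) :
    iotaOrdEpsTau R g = Ordinal.omega0 * (Ordinal.omega0 * (ν : Ordinal.{0})) := by
  have hg : g ∈ maximalIdeal R := by
    have h := Ideal.pow_le_pow_right hν hgν
    rwa [pow_one] at h
  rw [iotaOrdEpsTau_apply, iotaOrdEps_apply, (iotaOrd_eq_natCast_iff R g ν).mpr ⟨hgν, hgν1⟩,
    iotaEps_eq_zero_of_isIsolatedPosition hiso, iotaTau_eq_zero_of_isIsolatedPosition hdim hg hiso, add_zero, add_zero]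

/-- At an isolated position of Krull dimension `≤ 3` (`g ∈ 𝔪_R`) the top `ι₀`-stratum is the closed point. [OURS · L1 W4.3] -/
theorem topStratum_iotaOrdEpsTau_eq_closedPoint_of_isIsolatedPosition (hdim : ringKrullDim R ≤ 3) (hg : g ∈ maximalIdeal R)
    (hiso : IsIsolatedPosition R g) : topStratum iotaOrdEpsTau R g = {𝔮 | maximalIdeal R ≤ 𝔮.asIdeal} := by
  have hτ := iotaTau_eq_zero_of_isIsolatedPosition hdim hg hiso
  have hnt : ¬ IsTiePosition R g := (iotaTau_eq_zero_iff_not_isTiePosition hdim g).mp hτ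
  rw [topStratum_iotaOrdEpsTau_eq_topStratum_iotaOrdEps hdim hnt,
    topStratum_iotaOrdEps_eq_topStratum_iotaOrd_of_iotaEps_eq_zero hg (iotaEps_eq_zero_of_isIsolatedPosition hiso)]
  exact hiso

/-- **At an isolated position the `σ`-cylinder is read pointwise**: `iotaCylinder ι₀ σ R g = σ(R, g)` (Krull dimension `≤ 3`,
`g ∈ 𝔪_R`). [OURS · L1 W4.3] -/
theorem iotaCylinder_eq_iotaSigma_of_isIsolated (hdim : ringKrullDim R ≤ 3) (hg : g ∈ maximalIdeal R)
    (hiso : IsIsolatedPosition R g) : iotaCylinder iotaOrdEpsTau iotaSigma R g = iotaSigma R g :=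
  iotaCylinder_eq_self_of_topStratum_eq_closedPoint iotaOrdEpsTau iotaSigma iotaSigma_isoInvariant R g
    (topStratum_iotaOrdEpsTau_eq_closedPoint_of_isIsolatedPosition hdim hg hiso)

end Isolated

section Reduction

variable {S : Type} [CommRing S] [IsRegularLocalRing S] {f : S}
variable {R : Type} [CommRing R] [IsRegularLocalRing R] {g : R}

/-- **The stratifiers agree** between a curve-centre door position `(S, f)` (`topStratum ι₀ S f = V(P)`, `P ≠ 𝔪`, `f ∈ P`,
`f ∈ 𝔪^ν ∖ 𝔪^{ν+1}`) and an isolated position `(R, g)` of the same order (`g ∈ 𝔪_R^ν ∖ 𝔪_R^{ν+1}`), both of Krull dimension `≤ 3`: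
`ι₀(R, g) = ι₀(S, f)`. [OURS · L1 W4.3] -/
theorem iotaOrdEpsTau_eq_of_curve_of_isIsolated (hdimS : ringKrullDim S ≤ 3) (hf0 : f ≠ 0) (P : Ideal S) [P.IsPrime]
    (hfP : f ∈ P) (hE : topStratum iotaOrdEpsTau S f = {𝔮 | P ≤ 𝔮.asIdeal}) (hPm : P ≠ maximalIdeal S)
    {ν : ℕ} (hfν : f ∈ maximalIdeal S ^ ν) (hfν1 : f ∉ maximalIdeal S ^ (ν + 1))
    (hdimR : ringKrullDim R ≤ 3) (hgν : g ∈ maximalIdeal R ^ ν) (hgν1 : g ∉ maximalIdeal R ^ (ν + 1))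
    (hiso : IsIsolatedPosition R g) : iotaOrdEpsTau R g = iotaOrdEpsTau S f := by
  have hν : 1 ≤ ν := by
    rcases Nat.eq_zero_or_pos ν with h | h
    · subst h
      exact absurd (by rw [zero_add, pow_one]; exact IsLocalRing.le_maximalIdeal (Ideal.IsPrime.ne_top ‹_›) hfP) hfν1
    · exact h
  rw [iotaOrdEpsTau_eq_of_isIsolatedPosition hdimR hν hgν hgν1 hiso,
    iotaOrdEpsTau_eq_of_topStratum_eq_of_ne hdimS hf0 P hfP hE hPm hfν hfν1]

/-- **(D-b³-curve-FRAC-TIE-ZERO) ⟸ (ISO) + (SIGMA), abstract form.**  Between a curve-centre door position `(S, f)` and an isolated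
position `(R, g)` of the same order (Krull dimensions `≤ 3`), `ι₃ᵗ(R, g) < ι₃ᵗ(S, f)` IFF `σ(R, g) < σ(S_P, f/1)`: the stratifiers agree,
the `σ`-cylinder of `S` is read at the generic point `P` of the centre and that of `R` pointwise. [OURS · L1 W4.3 · TIE-LOCUS §2]
[cite: AbramovichTemkinWlodarczyk2024, §5] -/
theorem iotaFlatT_lt_iff_iotaSigma_lt_of_curve_of_isIsolated (hdimS : ringKrullDim S ≤ 3) (hf0 : f ≠ 0) (P : Ideal S)
    [P.IsPrime] (hfP : f ∈ P) (hE : topStratum iotaOrdEpsTau S f = {𝔮 | P ≤ 𝔮.asIdeal}) (hPm : P ≠ maximalIdeal S)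
    {ν : ℕ} (hfν : f ∈ maximalIdeal S ^ ν) (hfν1 : f ∉ maximalIdeal S ^ (ν + 1))
    (hdimR : ringKrullDim R ≤ 3) (hgν : g ∈ maximalIdeal R ^ ν) (hgν1 : g ∉ maximalIdeal R ^ (ν + 1))
    (hiso : IsIsolatedPosition R g) :
    iotaFlatT R g < iotaFlatT S f ↔
      iotaSigma R g < iotaSigma (Localization.AtPrime P) (algebraMap S (Localization.AtPrime P) f) := by
  have hν : 1 ≤ ν := by
    rcases Nat.eq_zero_or_pos ν with h | h
    · subst h
      exact absurd (by rw [zero_add, pow_one]; exact IsLocalRing.le_maximalIdeal (Ideal.IsPrime.ne_top ‹_›) hfP) hfν1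
    · exact h
  have hg : g ∈ maximalIdeal R := by
    have h := Ideal.pow_le_pow_right hν hgν
    rwa [pow_one] at h
  have h0 := iotaOrdEpsTau_eq_of_curve_of_isIsolated hdimS hf0 P hfP hE hPm hfν hfν1 hdimR hgν hgν1 hiso
  rw [iotaFlatT_lt_iff, h0, iotaCylinder_eq_iotaSigma_of_isIsolated hdimR hg hiso,
    iotaCylinder_eq_of_topStratum_eq iotaOrdEpsTau iotaSigma S f hE]
  constructor
  · rintro (h | ⟨-, h⟩)
    · exact absurd h (lt_irrefl _)
    · exact h
  · exact fun h => Or.inr ⟨rfl, h⟩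

/-- **(D-b³-curve-FRAC-TIE-ZERO) ⟸ (ISO) + (SIGMA)** — the direction used by the door: `σ(R, g) < σ(S_P, f/1)` ⟹
`ι₃ᵗ(R, g) < ι₃ᵗ(S, f)`. [OURS · L1 W4.3 · TIE-LOCUS §2] [cite: AbramovichTemkinWlodarczyk2024, §5] -/
theorem iotaFlatT_lt_of_curve_of_isIsolated_of_iotaSigma_lt (hdimS : ringKrullDim S ≤ 3) (hf0 : f ≠ 0) (P : Ideal S)
    [P.IsPrime] (hfP : f ∈ P) (hE : topStratum iotaOrdEpsTau S f = {𝔮 | P ≤ 𝔮.asIdeal}) (hPm : P ≠ maximalIdeal S)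
    {ν : ℕ} (hfν : f ∈ maximalIdeal S ^ ν) (hfν1 : f ∉ maximalIdeal S ^ (ν + 1))
    (hdimR : ringKrullDim R ≤ 3) (hgν : g ∈ maximalIdeal R ^ ν) (hgν1 : g ∉ maximalIdeal R ^ (ν + 1))
    (hiso : IsIsolatedPosition R g)
    (hσ : iotaSigma R g < iotaSigma (Localization.AtPrime P) (algebraMap S (Localization.AtPrime P) f)) :
    iotaFlatT R g < iotaFlatT S f :=
  (iotaFlatT_lt_iff_iotaSigma_lt_of_curve_of_isIsolated hdimS hf0 P hfP hE hPm hfν hfν1 hdimR hgν hgν1 hiso).mpr hσ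

/-- Conversely, WITHOUT the `σ`-drop the invariant does not drop: given (ISO), (D-b³-curve-FRAC-TIE-ZERO) at this successor is
EQUIVALENT to (SIGMA) (the disprover's target if (SIGMA) fails). [OURS · L1 W4.3] -/
theorem not_iotaFlatT_lt_of_curve_of_isIsolated_of_not_iotaSigma_lt (hdimS : ringKrullDim S ≤ 3) (hf0 : f ≠ 0) (P : Ideal S)
    [P.IsPrime] (hfP : f ∈ P) (hE : topStratum iotaOrdEpsTau S f = {𝔮 | P ≤ 𝔮.asIdeal}) (hPm : P ≠ maximalIdeal S)
    {ν : ℕ} (hfν : f ∈ maximalIdeal S ^ ν) (hfν1 : f ∉ maximalIdeal S ^ (ν + 1))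
    (hdimR : ringKrullDim R ≤ 3) (hgν : g ∈ maximalIdeal R ^ ν) (hgν1 : g ∉ maximalIdeal R ^ (ν + 1))
    (hiso : IsIsolatedPosition R g)
    (hσ : ¬ iotaSigma R g < iotaSigma (Localization.AtPrime P) (algebraMap S (Localization.AtPrime P) f)) :
    ¬ iotaFlatT R g < iotaFlatT S f := fun h =>
  hσ ((iotaFlatT_lt_iff_iotaSigma_lt_of_curve_of_isIsolated hdimS hf0 P hfP hE hPm hfν hfν1 hdimR hgν hgν1 hiso).mp h)

end Reduction

end Iota3

end Summit.ResolutionOfSingularities.ResolutionOfSingularities.Cruxes.HypersurfaceCentreConstruction.LocalEngine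

end
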